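import Literature.MathematicalPhysics.QuantumFieldTheory.Balaban1983to89.T4Apex
import Literature.MathematicalPhysics.QuantumFieldTheory.Balaban1983to89.BlockAveragingSU2

/-!
# The carrier `FiniteEpsData F G` of the `T⁴` targets is INHABITED by block-averaged data — a labelled placeholder, and the exact residual for `su2Mean`

Cell `pub-balaban`, T⁴ sub-cell, row **T4-D.G** of `t4/T4-DAG.md` v2 (term-building; successor of rows T4-D.L / T4-D.L-SU2,
tree `BlockAveraging` / `BlockAveragingSU2`).  Bookkeeping / typing only; NO analytic content of the series is proved or
asserted; value = NON-VACUITY of the universally quantified data `D : T4Continuum.FiniteEpsData F G` of the targets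
(`T4Continuum.YM4TorusContinuumSU2`, `T4Apex.YM4TorusContinuumBlockSU`) together with the predicate
`T4Continuum.FiniteEpsData.IsBlockAveraged` (`T4Apex`), and the precise measure-theoretic RESIDUAL for Bałaban's own averaging
on `SU(2)`; NOT summit progress.

WHAT IS BUILT, AND WHAT IT IS NOT (honest labelling, as the row demands).  For a lattice family `F`, a regular gauge group
`G : Type` with Haar data, and a family of block averagings `av K j : T^{(j)} → T^{(j+1)}` of the `K`-th torus that is
MEASURABLE and whose push-forward of product Haar measure is ABSOLUTELY CONTINUOUS with respect to product Haar measure in the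
standing range (`HaarAC`, §1 — the single named input), the term `stubData F G av … : FiniteEpsData F G` (§3) has

* `av` = THE GIVEN AVERAGINGS — the one field the predicate `IsBlockAveraged` reads; for `av K j := BlockAveraging.blockAvg ℰ`
  this is Bałaban's one-level block averaging [Balaban1987RG1] (0.4) p. 253 driven by the small-loop average `ℰ`
  (`BlockAveraging`, `BlockAveragingSU2.su2Mean`);
* `real.rho_zero`: `ρ₀` = the Wilson–Boltzmann weight `exp(−A(U)/g₀²)` ITSELF (constant `c = 1`) — [Balaban1988Convergent]
  pp. 243–244, the locus certified for `T4Continuum.Realisation`; HONEST;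
* `real.Trho`, `real.isRT_Trho`: `Tρ_k` = the Radon–Nikodym transport `AveragingRT.rnTransport` of `ρ_k` along `av K k`
  ([Balaban1987RG1] (0.13) p. 254 in the push-forward reading `Setup.IsRT` of [Balaban1985Averaging] (10) p. 19; tree
  `AveragingRT` §7, whose Haar-COMPATIBILITY hypothesis `map avg dU = dV` is weakened here to absolute continuity, which is
  all its proof uses), iterated: `ρ_k = T^k ρ₀` (`rtIterate`, §2); HONEST transforms of an honest start;
* `real.R := id` — a PLACEHOLDER: Bałaban's large-field operation `R` ([Balaban1988Convergent] (0.2) p. 244,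
  [Balaban1989LargeFieldI] (0.4) p. 176) is reader-owned data in the tree and is NOT modelled; `(0.4)` holds trivially for the
  identity, and the inhabitant says NOTHING about `R`;
* `C := stubConstruction …` — a PLACEHOLDER `B16.Construction`: configuration spaces `Cfg k := GaugeField (F.P K) k G` (the
  dictionary `cfg` is the identity), densities `ρ k := T^k ρ₀` as above, the CONSTANT coupling flow `g_k = g₀` with ZERO
  β-functions (the forward solution of [Balaban1987RG1] (0.20) for `β ≡ 0`, so `DagBinding.CurriesHBeta` and
  `DagBinding.ForwardGenerated` hold by arithmetic for `βfun := 0`), and `dom := ∅`, `effAction = wilsonBG = Ek := 0`,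
  `numSites := 0`, `χ := 0`, `Repr = IndAss = Sect2Form := False` — the placeholder asserts NONE of Bałaban's representations.
  CONSEQUENTLY `B16.Thm1Printed C` is FALSE (`not_thm1Printed_stub`: the run `(K, m, g₀) = (0, F.m, γ)` lies in `]0, γ]` and
  `Sect2Form 0` is `False`), so `B16.EndStatementBPrinted C` fails (`not_endStatementBPrinted_stub`) and every target of
  `T4Continuum` holds VACUOUSLY AT THIS `D`: the inhabitant is evidence about the TYPES (the carrier, the dictionary
  `Realisation`, the predicate `IsBlockAveraged` are jointly consistent and non-empty), never about the targets.

RESULTS.  §1 `HaarAC`, `rtOpIOfAC` (renormalisation transformation of integrable densities from absolute continuity),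
`integrable_rnTransport_of_ac`; §2 `rtIterate` (`T^k ρ₀`), non-negative and integrable up to the top level; §3 the placeholder
construction, its forward generation by `βfun = 0`, the `Realisation`, `stubData`, `¬ EndStatementBPrinted`; §4 the
inhabitants: `exists_isBlockAveraged_of_haarAC` — for EVERY small-loop average `ℰ` with measurable `E`
(`LoopAverage.MeasurableE`) whose block averaging satisfies `HaarAC` in the standing range, `∃ D : FiniteEpsData F G,
D.IsBlockAveraged ℰ`; UNCONDITIONALLY for the trivial small-loop average (`exists_isBlockAveraged_trivial`,
`nonempty_finiteEpsData`; then `blockAvg = axial`, Haar-compatible by `AveragingRT.map_axialAvg`), in particular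
`Nonempty (FiniteEpsData F SU(N))`; and for `su2Mean` CONDITIONALLY on `HaarAC` of its block averaging
(`exists_isBlockAveraged_su2Mean_of_haarAC`); §5 the CONVERSE at the bottom level: ANY `Realisation` (any construction, any
`R`) transforms the strictly positive density `ρ₀` along `av K 0`, which forces `HaarAC (av K 0).avg` for `K ≥ 1`
(`haarAC_of_realisation`, `haarAC_of_isBlockAveraged`, `haarAC_of_exists_isBlockAveraged_su2Mean`) — so at level `0` the named
input is NECESSARY as well, and row T4-D.G for `su2Mean` is bracketed exactly by `HaarAC`.

THE RESIDUAL (row T4-D.G for `su2Mean` is REDUCED, not closed; cell GAPS).  `HaarAC` for `BlockAveraging.avgFun su2Mean` —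
absolute continuity of the law of `Ū = (Ū(c))_c` under product Haar measure on the fine bonds — is the statement that
Bałaban's averaging map `SU(2)^{bonds of T^{(j)}} → SU(2)^{bonds of T^{(j+1)}}` ((0.4) with the quaternionic projected mean,
guarded total extension) pushes product Haar measure to an absolutely continuous measure; the natural route to it (the map is
real-analytic on the pieces of the guard and should be submersive almost everywhere; push-forwards of absolutely continuous
measures under a.e.-submersive smooth maps are absolutely continuous — coarea) is real analysis available neither in Mathlib
nor in print: (0.13) p. 254 writes `T` with a general gauge-invariant kernel `t(V, U)`; the δ-kernel — B7 (10) p. 19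
`ρ′(V) = ∫ dU δ(VŪ⁻¹) ρ(U)`, i.e. the "equalities `Ū = V` in the definitions of [9, 16]" instance named on p. 254, and the form
`∏_c δ(Ū(c)V⁻¹(c))` actually used in (0.17)/(0.19) p. 255 — is the reading typed by the cell's `Setup.IsRT`, and for it the
existence of `Tρ` as a function of `V` (dV-a.e.) is exactly the absolute continuity above, which print takes for granted (cell
GAPS G-pv26g2-1).  Whether `HaarAC` holds for `su2Mean` is NOT decided here.

Register: [Balaban1987RG1] = Commun. Math. Phys. 109 (1987) 249–301 (cell B12); [Balaban1985Averaging] = Commun. Math. Phys.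
98 (1985) 17–51 (B7); [Balaban1988Convergent] = Commun. Math. Phys. 119 (1988) 243–285 (B14); [Balaban1989LargeFieldI] =
Commun. Math. Phys. 122 (1989) 175–202 (B15); [Balaban1989LargeFieldII] = Commun. Math. Phys. 122 (1989) 355–392 (B16).  No
quotation locus is new in this module: every page reference above is one certified for `T4Continuum` (v5), `AveragingRT`,
`BlockAveraging` or `BlockAveragingSU2` (cell GAPS C-t4l-1, C-pv26g2-3, C-ref6-28).

REVISION v1.1 (docstring-only; cross-read C-ref5-46 R1): the header's RESIDUAL paragraph and the `HaarAC` docstring now say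
that (0.13) p.254 is printed with a general kernel `t(V, U)` and that the δ-kernel is the B7 (10) / "[9, 16]" / (0.17)–(0.19)
instance; no declaration changed.
-/

open MeasureTheory

namespace Literature.MathematicalPhysics.QuantumFieldTheory.Balaban1983to89

open Missing AveragingRT T4Continuum

namespace T4FiniteEpsInhabited

/-! ## 1. Renormalisation transformations of integrable densities from ABSOLUTE CONTINUITY of the push-forward -/

section AC

variable {P : Params} {j : ℕ} {G : Type*} [GaugeGroup G] [MeasurableSpace G] [HaarData G]

/-- `HaarAC avg`: the push-forward of product Haar measure `dU` on `T^{(j)}`-fields under the averaging is absolutely continuous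
with respect to product Haar measure `dV` on `T^{(j+1)}`-fields — the measure-theoretic content of "`ρ′(V) = ∫ dU δ(VŪ⁻¹) ρ(U)`
is a function of `V`" for the δ-KERNEL reading of the renormalization transformation ([Balaban1985Averaging] (10) p.19; in
[Balaban1987RG1] the general form (0.13) p.254 has a gauge-invariant kernel `t(V, U)`, the δ-kernel being its "`Ū = V` … of
[9, 16]" instance and the form `∏_c δ(Ū(c)V⁻¹(c))` used in (0.17)/(0.19) p.255); weaker than the Haar compatibility
`map avg dU = dV` of `AveragingRT`. [cite: Balaban1985Averaging, (10) p.19; Balaban1987RG1, (0.13) p.254, (0.17) p.255] -/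
def HaarAC (avg : GaugeField P j G → GaugeField P (j+1) G) : Prop :=
  (fieldMeasure P j G).map avg ≪ fieldMeasure P (j+1) G

/-- Haar compatibility implies `HaarAC`. [folklore] -/
theorem haarAC_of_map_eq (avg : GaugeField P j G → GaugeField P (j+1) G)
    (hmap : (fieldMeasure P j G).map avg = fieldMeasure P (j+1) G) : HaarAC avg := by
  rw [HaarAC, hmap]

/-- Under `HaarAC` the push-forward of `φ⁺ dU` is absolutely continuous with respect to `dV`. [folklore] -/
theorem pushDensity_absolutelyContinuous (avg : GaugeField P j G → GaugeField P (j+1) G) (havg : Measurable avg)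
    (hac : HaarAC avg) (φ : Density P j G) : pushDensity avg φ ≪ fieldMeasure P (j+1) G :=
  ((withDensity_absolutelyContinuous (fieldMeasure P j G) (fun U => ENNReal.ofReal (φ U))).map havg).trans hac

/-- THE RADON–NIKODYM IDENTITY of `AveragingRT.integral_rnDensity_mul` with Haar compatibility weakened to `HaarAC`:
`∫ dV (d avg_*(φ⁺dU)/dV)(V) f(V) = ∫ dU φ⁺(U) f(Ū)` for integrable `φ` and bounded measurable `f`, with integrability of the left
integrand (same proof; the tree's uses its hypothesis `hmap` only through absolute continuity). [folklore] -/
theorem integral_rnDensity_mul_of_ac (avg : GaugeField P j G → GaugeField P (j+1) G) (havg : Measurable avg)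
    (hac : HaarAC avg) (φ : Density P j G) (hφ : Integrable φ (fieldMeasure P j G))
    (f : GaugeField P (j+1) G → ℝ) (hf : Measurable f) (C : ℝ) (hC : ∀ V, |f V| ≤ C) :
    Integrable (fun V => rnDensity avg φ V * f V) (fieldMeasure P (j+1) G) ∧
      ∫ V, rnDensity avg φ V * f V ∂(fieldMeasure P (j+1) G)
        = ∫ U, max (φ U) 0 * f (avg U) ∂(fieldMeasure P j G) := by
  haveI : IsFiniteMeasure ((fieldMeasure P j G).withDensity fun U => ENNReal.ofReal (φ U)) :=
    isFiniteMeasure_withDensity_ofReal hφ.hasFiniteIntegral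
  haveI : IsFiniteMeasure (pushDensity avg φ) := by unfold pushDensity; infer_instance
  have hac' : pushDensity avg φ ≪ fieldMeasure P (j+1) G := pushDensity_absolutelyContinuous avg havg hac φ
  have hfi : Integrable f (pushDensity avg φ) := integrable_of_abs_le hf C hC
  refine ⟨(integrable_toReal_rnDeriv_mul_iff hac').mpr hfi, ?_⟩
  show ∫ V, ((pushDensity avg φ).rnDeriv (fieldMeasure P (j+1) G) V).toReal * f V ∂(fieldMeasure P (j+1) G) = _
  rw [integral_toReal_rnDeriv_mul hac']
  unfold pushDensity
  rw [integral_map havg.aemeasurable hf.aestronglyMeasurable,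
    integral_withDensity_eq_integral_toReal_smul₀ hφ.aemeasurable.ennreal_ofReal
      (Filter.Eventually.of_forall fun _ => ENNReal.ofReal_lt_top)]
  simp only [ENNReal.toReal_ofReal', smul_eq_mul]

/-- `rnTransport avg ρ` IS a renormalisation transform (`Setup.IsRT`) of every integrable density `ρ` along a measurable averaging
satisfying `HaarAC`. [cite: Balaban1987RG1, (0.13) p.254] -/
theorem isRT_rnTransport_of_ac (avg : GaugeField P j G → GaugeField P (j+1) G) (havg : Measurable avg)
    (hac : HaarAC avg) (ρ : Density P j G) (hρ : Integrable ρ (fieldMeasure P j G)) :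
    IsRT avg ρ (rnTransport avg ρ) := by
  intro f hf hfC
  obtain ⟨C, hC⟩ := hfC
  have hp := integral_rnDensity_mul_of_ac avg havg hac ρ hρ f hf C hC
  have hn := integral_rnDensity_mul_of_ac avg havg hac (fun U => - ρ U) hρ.neg f hf C hC
  have hfb : ∀ U, ‖f (avg U)‖ ≤ C := fun U => by simpa [Real.norm_eq_abs] using hC (avg U)
  have I1 : Integrable (fun U => max (ρ U) 0 * f (avg U)) (fieldMeasure P j G) :=
    hρ.pos_part.mul_bdd (hf.comp havg).aestronglyMeasurable (Filter.Eventually.of_forall hfb)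
  have I2 : Integrable (fun U => max (- ρ U) 0 * f (avg U)) (fieldMeasure P j G) :=
    hρ.neg_part.mul_bdd (hf.comp havg).aestronglyMeasurable (Filter.Eventually.of_forall hfb)
  by_cases h0 : ∀ U, 0 ≤ ρ U
  · simp only [rnTransport, if_pos h0]
    rw [hp.2]
    congr 1
    funext U
    rw [max_eq_left (h0 U)]
  · simp only [rnTransport, if_neg h0, sub_mul]
    rw [integral_sub hp.1 hn.1, hp.2, hn.2, ← integral_sub I1 I2]
    congr 1
    funext U
    rw [← sub_mul, max_zero_sub_max_neg_zero_eq_self]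

/-- The transform of an integrable density is integrable (take `f ≡ 1`). [folklore] -/
theorem integrable_rnTransport_of_ac (avg : GaugeField P j G → GaugeField P (j+1) G) (havg : Measurable avg)
    (hac : HaarAC avg) (ρ : Density P j G) (hρ : Integrable ρ (fieldMeasure P j G)) :
    Integrable (rnTransport avg ρ) (fieldMeasure P (j+1) G) := by
  have h1 : ∀ V : GaugeField P (j+1) G, |(fun _ => (1 : ℝ)) V| ≤ 1 := fun _ => by simp
  have I1 := (integral_rnDensity_mul_of_ac avg havg hac ρ hρ (fun _ => 1) measurable_const 1 h1).1
  have I2 := (integral_rnDensity_mul_of_ac avg havg hac (fun U => - ρ U) hρ.neg (fun _ => 1) measurable_const 1 h1).1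
  simp only [mul_one] at I1 I2
  by_cases h0 : ∀ U, 0 ≤ ρ U
  · have : rnTransport avg ρ = rnDensity avg ρ := by funext V; simp [rnTransport, if_pos h0]
    rw [this]; exact I1
  · have : rnTransport avg ρ = fun V => rnDensity avg ρ V - rnDensity avg (fun U => - ρ U) V := by
      funext V; simp [rnTransport, if_neg h0]
    rw [this]; exact I1.sub I2

/-- CONSISTENCY CERTIFICATE for `Setup.RTOpI` under `HaarAC`: every measurable averaging whose push-forward of product Haar measure is
absolutely continuous carries an integrable-density renormalisation transformation (generalises `AveragingRT.rtOpIOfCompatible`).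
[cite: Balaban1987RG1, (0.13) p.254] -/
noncomputable def rtOpIOfAC (av : Averaging P j G) (havg : Measurable av.avg) (hac : HaarAC av.avg) : RTOpI P j G av where
  T := rnTransport av.avg
  isRT := fun ρ hρ => isRT_rnTransport_of_ac av.avg havg hac ρ hρ
  pos := fun ρ h0 V => rnTransport_nonneg av.avg ρ h0 V

end AC

/-! ## 2. The iterated transforms `ρ_k = T^k ρ₀` of the Wilson–Boltzmann weight along an averaging family -/

section Iterates

variable (F : T4Family) {G : Type*} [GaugeGroup G] [MeasurableSpace G] [HaarData G]
  (av : (K j : ℕ) → Averaging (F.P K) j G)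

/-- `ρ_k := T^k ρ₀` on the `K`-th torus of the family, run at bare coupling `g₀`: `ρ₀ = exp(−A(U)/g₀²)` (the Wilson–Boltzmann weight,
`Missing.boltzmann` at `β = g₀⁻²`), `ρ_{k+1} = T_{av K k} ρ_k` with `T` the Radon–Nikodym transport `AveragingRT.rnTransport`
([Balaban1988Convergent] (0.2) `ρ_k = (RT)^k ρ₀` with `R` omitted — see the module docstring). [cite: Balaban1988Convergent, (0.2) p.244] -/
noncomputable def rtIterate (K : ℕ) (g₀ : ℝ) : (k : ℕ) → Density (F.P K) k G
  | 0 => boltzmann (F.P K) (g₀⁻¹ ^ 2)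
  | k + 1 => rnTransport (av K k).avg (rtIterate K g₀ k)

/-- `ρ₀` is the Boltzmann weight. [folklore] -/
theorem rtIterate_zero (K : ℕ) (g₀ : ℝ) : rtIterate F av K g₀ 0 = boltzmann (F.P K) (g₀⁻¹ ^ 2) := rfl

/-- `ρ_{k+1} = T ρ_k`. [folklore] -/
theorem rtIterate_succ (K : ℕ) (g₀ : ℝ) (k : ℕ) :
    rtIterate F av K g₀ (k + 1) = rnTransport (av K k).avg (rtIterate F av K g₀ k) := rfl

/-- Every `ρ_k` is pointwise non-negative. [folklore] -/
theorem rtIterate_nonneg (K : ℕ) (g₀ : ℝ) : ∀ (k : ℕ) (U : GaugeField (F.P K) k G), 0 ≤ rtIterate F av K g₀ k U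
  | 0, U => (boltzmann_pos (F.P K) _ U).le
  | k + 1, U => rnTransport_nonneg _ _ (rtIterate_nonneg K g₀ k) U

variable [RegularGaugeGroup G]

/-- Along a measurable family satisfying `HaarAC` in the standing range `k < K`, every `ρ_k`, `k ≤ K`, is integrable. [folklore] -/
theorem integrable_rtIterate (hmeas : ∀ K j, Measurable (av K j).avg) (hac : ∀ K k, k < K → HaarAC (av K k).avg)
    (K : ℕ) (g₀ : ℝ) : ∀ k, k ≤ K → Integrable (rtIterate F av K g₀ k) (fieldMeasure (F.P K) k G)
  | 0, _ => integrable_boltzmann RegularGaugeGroup.measurable_reTr (F.P K) (sq_nonneg _)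
  | k + 1, hk =>
      integrable_rnTransport_of_ac _ (hmeas K k) (hac K k (Nat.lt_of_succ_le hk)) _
        (integrable_rtIterate hmeas hac K g₀ k (Nat.le_of_succ_le hk))

end Iterates

/-! ## 3. The placeholder construction, its forward generation, and the realisation -/

section Stub

variable (F : T4Family) (G : Type) [GaugeGroup G] [MeasurableSpace G] [HaarData G]
  (av : (K j : ℕ) → Averaging (F.P K) j G)

/-- THE PLACEHOLDER CONSTRUCTION (see the module docstring for the field-by-field labelling): constant coupling flow `g_k = g₀`
with zero β-functions; `Cfg k` = gauge fields on `T^{(k)}` of the `K`-th torus; `ρ k = T^k ρ₀` (`rtIterate`); every other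
field a zero / empty / `False` placeholder — it asserts NONE of [Balaban1987RG1] (0.22)–(0.24), the inductive assumptions, or
[Balaban1988Convergent] §2. [folklore] -/
noncomputable def stubConstruction : B16.Construction := fun p =>
  { flow := ⟨fun _ => p.g0, fun _ _ => 0⟩
    Cfg := fun k => GaugeField (F.P p.K) k G
    dom := fun _ => ∅
    effAction := fun _ _ => 0
    wilsonBG := fun _ _ => 0
    Ek := fun _ _ => 0
    numSites := fun _ => 0
    Repr := fun _ => False
    IndAss := fun _ => False
    ρ := fun k => rtIterate F av p.K p.g0 k
    χ := fun _ _ => 0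
    Sect2Form := fun _ => False }

/-- The zero history-dependent β-functions. [folklore] -/
def zeroHBeta : FlowStep.HBeta := fun _ _ => 0

/-- The placeholder's one-variable β-functions are the zero family curried (both sides are `0`). [folklore] -/
theorem curriesHBeta_stub : DagBinding.CurriesHBeta (stubConstruction F G av).toB12 zeroHBeta :=
  fun _ _ _ _ => rfl

/-- The constant flow is generated forward from the bare coupling by the zero β-functions:
`g_0 = g₀`, and `1/g_{k+1}² = 1/g_k² − 0` with `g_{k+1} = g₀ > 0` whenever `g_0 > 0`. [folklore] -/
theorem forwardGenerated_stub : DagBinding.ForwardGenerated (stubConstruction F G av).toB12 zeroHBeta := by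
  refine ⟨fun _ => rfl, fun p k _ hpos _ => ?_⟩
  have h0 : 0 < p.g0 := hpos 0 (Nat.zero_le _)
  refine ⟨h0, ?_⟩
  show 1 / p.g0 ^ 2 = 1 / p.g0 ^ 2 - 0
  rw [sub_zero]

/-- HONESTY CERTIFICATE: Theorem 1 of [Balaban1989LargeFieldII] in its typed form FAILS for the placeholder (the run `(0, F.m, γ)`
lies in `]0, γ]` and the placeholder's `Sect2Form 0` is `False`). [folklore] -/
theorem not_thm1Printed_stub : ¬ B16.Thm1Printed (stubConstruction F G av) := by
  rintro ⟨γ, hγ, h⟩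
  have hint : ((stubConstruction F G av) ⟨0, F.m, γ⟩).flow.InInterval γ 0 := fun k _ => ⟨hγ, le_rfl⟩
  exact h ⟨0, F.m, γ⟩ hint 0 le_rfl

/-- Hence the pinned end statement (B) fails for the placeholder: every `T4Continuum` target holds VACUOUSLY at the inhabitant
below, which is therefore evidence about the types only. [folklore] -/
theorem not_endStatementBPrinted_stub : ¬ B16.EndStatementBPrinted (stubConstruction F G av) :=
  fun h => not_thm1Printed_stub F G av h.1

/-- The placeholder satisfies the sign convention `χ_k ≥ 0` (with `χ := 0`). [folklore] -/
theorem signConventions_stub : B16.SignConventions (stubConstruction F G av) := fun _ _ _ => le_rfl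

variable [RegularGaugeGroup G]

/-- THE REALISATION of the placeholder by the given averagings: `cfg` = identity, `ρ₀` = the Boltzmann weight (`c = 1`),
`Tρ_k = ρ_{k+1}` = the Radon–Nikodym transport along `av K k` (an honest `Setup.IsRT` transform by §1, given measurability and
`HaarAC` in the standing range), `R := id` (placeholder; (0.4) trivial), `ρ_{k+1} = R (Tρ_k)` by definition. [cite: Balaban1988Convergent, (0.2) p.244] -/
noncomputable def stubRealisation (hmeas : ∀ K j, Measurable (av K j).avg) (hac : ∀ K k, k < K → HaarAC (av K k).avg) :
    T4Continuum.Realisation F G (stubConstruction F G av) av where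
  cfg := fun _ _ _ => Equiv.refl _
  rho_zero := fun _ _ => ⟨1, one_pos, fun _ => (one_mul _).symm⟩
  Trho := fun K g₀ k => rtIterate F av K g₀ (k + 1)
  isRT_Trho := fun K g₀ k hk =>
    isRT_rnTransport_of_ac _ (hmeas K k) (hac K k hk) _ (integrable_rtIterate F av hmeas hac K g₀ k hk.le)
  R := fun _ _ _ => id
  preservesIntegral_R := fun _ _ _ _ _ => rfl
  rho_succ_eq := fun _ _ _ _ => rfl

/-- THE INHABITANT: finite-`ε` data with the GIVEN averagings, realised on the placeholder construction (module docstring). [folklore] -/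
noncomputable def stubData (hmeas : ∀ K j, Measurable (av K j).avg) (hac : ∀ K k, k < K → HaarAC (av K k).avg) :
    T4Continuum.FiniteEpsData F G where
  C := stubConstruction F G av
  βfun := zeroHBeta
  curries := curriesHBeta_stub F G av
  fwd := forwardGenerated_stub F G av
  av := av
  real := stubRealisation F G av hmeas hac

/-- Its averagings are the given ones. [folklore] -/
@[simp] theorem stubData_av (hmeas : ∀ K j, Measurable (av K j).avg) (hac : ∀ K k, k < K → HaarAC (av K k).avg) :
    (stubData F G av hmeas hac).av = av := rfl

/-- Its construction is the placeholder — so (B) fails for it (`not_endStatementBPrinted_stub`). [folklore] -/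
@[simp] theorem stubData_C (hmeas : ∀ K j, Measurable (av K j).avg) (hac : ∀ K k, k < K → HaarAC (av K k).avg) :
    (stubData F G av hmeas hac).C = stubConstruction F G av := rfl

end Stub

/-! ## 4. The inhabitants -/

section Inhabitants

variable (F : T4Family) (G : Type) [GaugeGroup G] [MeasurableSpace G] [HaarData G] [RegularGaugeGroup G]

/-- **CONDITIONAL INHABITATION for every small-loop average.**  If `ℰ.E` is measurable in every arity and Bałaban's block averaging
(0.4) driven by `ℰ` satisfies `HaarAC` on every torus of the family in the standing range `k < K`, then block-averaged finite-`ε`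
data EXIST: `∃ D : FiniteEpsData F G, D.IsBlockAveraged ℰ`. [cite: Balaban1987RG1, (0.4) p.253] -/
theorem exists_isBlockAveraged_of_haarAC (ℰ : LoopAverage G) (hE : ℰ.MeasurableE)
    (hac : ∀ K k, k < K →
      HaarAC (BlockAveraging.avgFun ℰ : GaugeField (F.P K) k G → GaugeField (F.P K) (k + 1) G)) :
    ∃ D : T4Continuum.FiniteEpsData F G, D.IsBlockAveraged ℰ :=
  ⟨stubData F G (fun _ _ => BlockAveraging.blockAvg ℰ) (fun _ _ => BlockAveraging.measurable_avgFun ℰ hE) hac,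
    fun _ _ => rfl⟩

/-- With the trivial small-loop average the block averaging is the axial one, which is Haar-COMPATIBLE in the standing range
(`AveragingRT.map_axialAvg`), hence satisfies `HaarAC`. [folklore] -/
theorem haarAC_avgFun_trivial (K k : ℕ) (hk : k < K) :
    HaarAC (BlockAveraging.avgFun (LoopAverage.trivial G) : GaugeField (F.P K) k G → GaugeField (F.P K) (k + 1) G) := by
  have h : (BlockAveraging.avgFun (LoopAverage.trivial G) : GaugeField (F.P K) k G → GaugeField (F.P K) (k + 1) G)
      = axialAvg := funext (BlockAveraging.avgFun_trivial)
  rw [h]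
  exact haarAC_of_map_eq _ (map_axialAvg (by show k + 1 ≤ F.m + K; omega))

/-- **UNCONDITIONAL INHABITATION**: finite-`ε` data block-averaged by the trivial small-loop average exist on every family and every
regular gauge group. [folklore] -/
theorem exists_isBlockAveraged_trivial :
    ∃ D : T4Continuum.FiniteEpsData F G, D.IsBlockAveraged (LoopAverage.trivial G) :=
  exists_isBlockAveraged_of_haarAC F G _ LoopAverage.measurableE_trivial (fun K k hk => haarAC_avgFun_trivial F G K k hk)

/-- Hence the carrier of the targets is NON-EMPTY: the universal quantifier `∀ D : FiniteEpsData F G` of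
`T4Continuum.YM4TorusContinuumSU2` / `T4Apex.YM4TorusContinuumBlockSU` ranges over an inhabited type. [folklore] -/
theorem nonempty_finiteEpsData : Nonempty (T4Continuum.FiniteEpsData F G) := by
  obtain ⟨D, _⟩ := exists_isBlockAveraged_trivial F G
  exact ⟨D⟩

/-- In particular for `G = SU(N)`. [folklore] -/
theorem nonempty_finiteEpsData_SU (N : ℕ) [NeZero N] :
    Nonempty (T4Continuum.FiniteEpsData F (Matrix.specialUnitaryGroup (Fin N) ℂ)) :=
  nonempty_finiteEpsData F _

/-- `su2Mean.E` is measurable in every arity (`BlockAveragingSU2.measurable_su2Mean_E`, in the `T4Apex` vocabulary). [folklore] -/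
theorem measurableE_su2Mean : su2Mean.MeasurableE := measurable_su2Mean_E

/-- **ROW T4-D.G FOR BAŁABAN'S AVERAGING ON `SU(2)`, REDUCED TO ITS MEASURE-THEORETIC RESIDUAL**: if the block averaging (0.4) with
the quaternionic projected mean `su2Mean` satisfies `HaarAC` on every torus of the family in the standing range, then
`∃ D : FiniteEpsData F SU(2), D.IsBlockAveraged su2Mean` — and then ALL consequences recorded in `T4Apex` /
`BlockAveragingSU2` §6 apply to an existing `D`.  `HaarAC` for `su2Mean` is NOT proved here (module docstring, "THE RESIDUAL").
[cite: Balaban1987RG1, (0.4) p.253] -/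
theorem exists_isBlockAveraged_su2Mean_of_haarAC
    (hac : ∀ K k, k < K →
      HaarAC (BlockAveraging.avgFun su2Mean :
        GaugeField (F.P K) k (Matrix.specialUnitaryGroup (Fin 2) ℂ) →
          GaugeField (F.P K) (k + 1) (Matrix.specialUnitaryGroup (Fin 2) ℂ))) :
    ∃ D : T4Continuum.FiniteEpsData F (Matrix.specialUnitaryGroup (Fin 2) ℂ), D.IsBlockAveraged su2Mean :=
  exists_isBlockAveraged_of_haarAC F _ su2Mean measurableE_su2Mean hac

/-- And at ANY inhabitant produced by this module the pinned end statement (B) FAILS — the targets are vacuous there; the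
inhabitant certifies the types, not the theorems. [folklore] -/
theorem not_endStatementBPrinted_of_stubData (av : (K j : ℕ) → Averaging (F.P K) j G)
    (hmeas : ∀ K j, Measurable (av K j).avg) (hac : ∀ K k, k < K → HaarAC (av K k).avg) :
    ¬ B16.EndStatementBPrinted (stubData F G av hmeas hac).C :=
  not_endStatementBPrinted_stub F G av

end Inhabitants

/-! ## 5. `HaarAC` at the bottom level is FORCED by the dictionary `Realisation` (the residual is exact there) -/

section Forced

variable (F : T4Family) {G : Type*} [GaugeGroup G] [MeasurableSpace G] [HaarData G] [RegularGaugeGroup G]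

/-- CONVERSE AT LEVEL `0`: whatever the construction `C` and the averagings, a `Realisation` transforms the STRICTLY POSITIVE
integrable density `ρ₀ = c · exp(−A/g₀²)` along `av K 0` (`isRT_Trho`, `0 < K`); testing the push-forward identity on indicators of
`dV`-null sets shows that the push-forward of product Haar measure under a measurable `av K 0` is absolutely continuous.  So
`HaarAC` at level `0` of every torus `K ≥ 1` is NECESSARY for `FiniteEpsData` with these averagings — not an artefact of §3.
[cite: Balaban1985Averaging, (10) p.19] -/
theorem haarAC_of_realisation {C : B16.Construction} {av : (K j : ℕ) → Averaging (F.P K) j G}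
    (real : Realisation F G C av) (K : ℕ) (hK : 0 < K) (hmeas : Measurable (av K 0).avg) :
    HaarAC (av K 0).avg := by
  refine Measure.AbsolutelyContinuous.mk fun s hsm hs0 => ?_
  rw [Measure.map_apply hmeas hsm]
  obtain ⟨c, hc, hρ⟩ := real.rho_zero K 1
  have hRT := real.isRT_Trho K 1 0 hK (s.indicator fun _ => (1 : ℝ)) (measurable_const.indicator hsm)
    ⟨1, fun V => by by_cases hV : V ∈ s <;> simp [hV]⟩
  -- the left-hand side vanishes: an integral over a `dV`-null set
  have hL : ∫ V, real.Trho K 1 0 V * s.indicator (fun _ => (1 : ℝ)) V ∂(fieldMeasure (F.P K) (0 + 1) G) = 0 := by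
    have : (fun V => real.Trho K 1 0 V * s.indicator (fun _ => (1 : ℝ)) V) = s.indicator (real.Trho K 1 0) := by
      funext V; by_cases hV : V ∈ s <;> simp [hV]
    rw [this, integral_indicator hsm, setIntegral_measure_zero _ hs0]
  -- the right-hand side is `c · ∫_{Ū ∈ s} exp(−A) dU`
  set A : Set (GaugeField (F.P K) 0 G) := (av K 0).avg ⁻¹' s with hA
  have hAm : MeasurableSet A := hmeas hsm
  have hR : ∫ U, (C ⟨K, F.m, 1⟩).ρ 0 ((real.cfg K 1 0).symm U) * s.indicator (fun _ => (1 : ℝ)) ((av K 0).avg U)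
      ∂(fieldMeasure (F.P K) 0 G) = c * ∫ U in A, boltzmann (F.P K) ((1 : ℝ)⁻¹ ^ 2) U ∂(fieldMeasure (F.P K) 0 G) := by
    have : (fun U => (C ⟨K, F.m, 1⟩).ρ 0 ((real.cfg K 1 0).symm U) * s.indicator (fun _ => (1 : ℝ)) ((av K 0).avg U))
        = fun U => c * A.indicator (boltzmann (F.P K) ((1 : ℝ)⁻¹ ^ 2)) U := by
      funext U
      rw [hρ U]
      by_cases hU : U ∈ A
      · have hU' : (av K 0).avg U ∈ s := hU
        simp [hU, hU']
      · have hU' : (av K 0).avg U ∉ s := hU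
        simp [hU, hU']
    rw [this, integral_const_mul, integral_indicator hAm]
  rw [hL, hR] at hRT
  have hint : ∫ U in A, boltzmann (F.P K) ((1 : ℝ)⁻¹ ^ 2) U ∂(fieldMeasure (F.P K) 0 G) = 0 := by
    rcases mul_eq_zero.mp hRT.symm with h | h
    · exact absurd h hc.ne'
    · exact h
  -- a strictly positive integrable function has zero integral on `A` only if `A` is null
  by_contra hne
  have hpos : 0 < (fieldMeasure (F.P K) 0 G) A := pos_iff_ne_zero.mpr hne
  have hI : IntegrableOn (boltzmann (F.P K) ((1 : ℝ)⁻¹ ^ 2)) A (fieldMeasure (F.P K) 0 G) :=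
    (integrable_boltzmann RegularGaugeGroup.measurable_reTr (F.P K) (sq_nonneg _)).integrableOn
  have hsupp : Function.support (boltzmann (G := G) (F.P K) ((1 : ℝ)⁻¹ ^ 2)) = Set.univ :=
    Set.eq_univ_of_forall fun U => Function.mem_support.mpr (boltzmann_pos (F.P K) _ U).ne'
  have h0 : 0 < ∫ U in A, boltzmann (F.P K) ((1 : ℝ)⁻¹ ^ 2) U ∂(fieldMeasure (F.P K) 0 G) := by
    rw [setIntegral_pos_iff_support_of_nonneg_ae (Filter.Eventually.of_forall fun U => (boltzmann_pos (F.P K) _ U).le) hI,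
      hsupp, Set.univ_inter]
    exact hpos
  rw [hint] at h0
  exact lt_irrefl _ h0

/-- Hence for BLOCK-AVERAGED data: `D.IsBlockAveraged ℰ` with measurable `ℰ.E` forces `HaarAC` of the block averaging (0.4) at level
`0` of every torus `K ≥ 1` — the hypothesis of `exists_isBlockAveraged_of_haarAC` at `k = 0` is also NECESSARY. [cite: Balaban1987RG1, (0.4) p.253] -/
theorem haarAC_of_isBlockAveraged (D : FiniteEpsData F G) {ℰ : LoopAverage G} (h : D.IsBlockAveraged ℰ)
    (hE : ℰ.MeasurableE) (K : ℕ) (hK : 0 < K) :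
    HaarAC (BlockAveraging.avgFun ℰ : GaugeField (F.P K) 0 G → GaugeField (F.P K) (0 + 1) G) := by
  have hm : Measurable (D.av K 0).avg := by rw [h K 0]; exact BlockAveraging.measurable_avgFun ℰ hE
  have := haarAC_of_realisation F D.real K hK hm
  rwa [h K 0] at this

/-- In particular for `su2Mean`: block-averaged finite-`ε` data on `SU(2)` in the sense of row T4-D.G exist ONLY IF Bałaban's
averaging with the projected mean satisfies `HaarAC` at the bottom level of every torus — together with
`exists_isBlockAveraged_su2Mean_of_haarAC` this brackets the row exactly by `HaarAC`. [cite: Balaban1987RG1, (0.4) p.253] -/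
theorem haarAC_of_exists_isBlockAveraged_su2Mean
    (h : ∃ D : FiniteEpsData F (Matrix.specialUnitaryGroup (Fin 2) ℂ), D.IsBlockAveraged su2Mean) (K : ℕ) (hK : 0 < K) :
    HaarAC (BlockAveraging.avgFun su2Mean :
      GaugeField (F.P K) 0 (Matrix.specialUnitaryGroup (Fin 2) ℂ) →
        GaugeField (F.P K) (0 + 1) (Matrix.specialUnitaryGroup (Fin 2) ℂ)) := by
  obtain ⟨D, hD⟩ := h
  exact haarAC_of_isBlockAveraged F D hD measurable_su2Mean_E K hK

end Forced

end T4FiniteEpsInhabited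

end Literature.MathematicalPhysics.QuantumFieldTheory.Balaban1983to89
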